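import Mathlib
import Summits.NavierStokesRegularity.NavierStokesRegularity.Theses.TypeIQuarterGate
import HarnessLib

/-!
# `TypeIQuarterGate.QuarterLawTypeIGlue` — glue of the scar-envelope split of `QuarterLawTypeI`
(item stmt-NavierStokesRegularity-23845; pure logic)

**Statement.** `FiniteScarsTypeI → ScarEnvelopeTypeI → EnvelopeQuarterLaw → QuarterLawTypeI`.

PROOF. For a maximal classical Leray–Hopf solution from a rapidly decaying datum with a Type-I
blow-up: child S1 gives finitely many scars, child S2 turns them into the scar envelope
`|u(t,x)| ≤ C' + Σ_a C'/(|x−a| + √(T−t))`, child S3 turns the envelope into the quarter law.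

HONEST FRAMING: pure logic between the route's own statements (children ⟹ parent); all three
children stay hypotheses; nothing here bears on Navier–Stokes regularity.
-/

noncomputable section

set_option linter.dupNamespace false

namespace Summit.NavierStokesRegularity.NavierStokesRegularity.Theorems

open Summit.NavierStokesRegularity.NavierStokesRegularity.Theses.TypeIQuarterGate in
/-- **Item stmt-NavierStokesRegularity-23845** (`TypeIQuarterGate.QuarterLawTypeIGlue`): finite scars →
scar envelope → quarter law, composed. Pure logic. [this file] -/
theorem typeIQuarterGate_quarterLawTypeIGlue_proof :
    Summit.NavierStokesRegularity.NavierStokesRegularity.Theses.TypeIQuarterGate.QuarterLawTypeIGlue := by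
  unfold Summit.NavierStokesRegularity.NavierStokesRegularity.Theses.TypeIQuarterGate.QuarterLawTypeIGlue
    Summit.NavierStokesRegularity.NavierStokesRegularity.Theses.TypeIQuarterGate.FiniteScarsTypeI
    Summit.NavierStokesRegularity.NavierStokesRegularity.Theses.TypeIQuarterGate.ScarEnvelopeTypeI
    Summit.NavierStokesRegularity.NavierStokesRegularity.Theses.TypeIQuarterGate.EnvelopeQuarterLaw
    Summit.NavierStokesRegularity.NavierStokesRegularity.Theses.TypeIQuarterGate.QuarterLawTypeI
  intro h₁ h₂ h₃ ν T hν hT u p hmax hLH hdec hI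
  exact h₃ ν T hν hT u p hmax hLH hdec
    (h₂ ν T hν hT u p hmax hLH hdec hI (h₁ ν T hν hT u p hmax hLH hdec hI))

end Summit.NavierStokesRegularity.NavierStokesRegularity.Theorems

end
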